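import Summits.RiemannHypothesis.RiemannHypothesis.Theorems.TiltedLandingLaw421Seam07

/-! # TiltedLandingLaw421 — descent seam, part 08
Token-identical port of the descent framework of `Cruxes/TiltedLandingLaw421/Lines/law421birthS.lean`
(seam canon ce03e18b) into flat Theorems modules, so that crux line files can import it instead of inlining it.
No new mathematics; no `sorry`; no route (Theses) imports — the tree statement is mirrored as `RhW07.Seam.Law421Statement`. -/

open Complex Metric Set
open scoped ComplexConjugate
namespace RhW07.C11.DescentSplit.C3

/-- `succCol_step` — seam of the TiltedLandingLaw421 descent framework, part 08 (token-identical port of `Cruxes/TiltedLandingLaw421/Lines/law421birthS.lean`; no new mathematics). -/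
theorem succCol_step {f : ℂ → ℂ} (hf : Differentiable ℂ f) {x₀ s hmax R μ σ : ℝ} (hμs : 0 ≤ μ * s) {j : ℕ} {u : ℂ}
    (hSt : iteratedDeriv j f ≠ 0 ∧ iteratedDeriv j f u = 0 ∧ 0 < u.im ∧ |u.re - x₀| ≤ R / 2 + (j : ℝ) * σ ∧ u.im ≤ hmax)
    (hS : SuccColAt (μ * s) σ (iteratedDeriv j f) u) :
    ∃ u' : ℂ, (iteratedDeriv (j + 1) f ≠ 0 ∧ iteratedDeriv (j + 1) f u' = 0 ∧ 0 < u'.im ∧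
      |u'.re - x₀| ≤ R / 2 + (((j + 1 : ℕ)) : ℝ) * σ ∧ u'.im ≤ hmax) ∧ |u'.im| + μ * s ≤ |u.im| := by
  obtain ⟨hne, hu0, huim, hure, huh⟩ := hSt
  obtain ⟨z₁, hz, him, hre, hle⟩ := succColAt_successor hS
  have hFd : Differentiable ℂ (iteratedDeriv j f) :=
    Literature.Analysis.Complex.differentiable_iteratedDeriv_of_entire hf j
  have hne' : iteratedDeriv (j + 1) f ≠ 0 := by
    intro h0
    have hconst := is_const_of_deriv_eq_zero hFd (fun x ↦ by rw [← iteratedDeriv_succ, h0]; rfl)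
    exact hne (funext fun x ↦ by rw [hconst x u, hu0]; rfl)
  refine ⟨z₁, ⟨hne', hz, him, ?_, by linarith⟩, ?_⟩
  · have h1 : |z₁.re - x₀| ≤ |z₁.re - u.re| + |u.re - x₀| := abs_sub_le _ _ _
    have h2 : (((j + 1 : ℕ)) : ℝ) * σ = (j : ℝ) * σ + σ := by push_cast; ring
    rw [h2]; linarith
  · rw [abs_of_pos him, abs_of_pos huim]; linarith

end RhW07.C11.DescentSplit.C3
namespace RhIdea6.G19.W07C11.Seam
open RhIdea6.G17.W07C7 RhIdea6.G17.W07C7.Rev6 RhIdea6.G18.W07C8.Law421BirthS RhW07.C11.DescentSplit.C3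
/-- `SuccColQ` — seam of the TiltedLandingLaw421 descent framework, part 08 (token-identical port of `Cruxes/TiltedLandingLaw421/Lines/law421birthS.lean`; no new mathematics). -/
def SuccColQ (μ : ℝ) : StatePred := fun _η f _x₀ s _hmax _R _Hs _B j u => SuccColAt (μ * s) (s / 4) (iteratedDeriv j f) u

/-- `frozenStepSig_succColQ` — seam of the TiltedLandingLaw421 descent framework, part 08 (token-identical port of `Cruxes/TiltedLandingLaw421/Lines/law421birthS.lean`; no new mathematics). -/
theorem frozenStepSig_succColQ {μ : ℝ} (hμ : 0 ≤ μ) (Ready : StatePred) : FrozenStepSig μ StCol Ready (SuccColQ μ) := by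
  intro η f x₀ s hmax R Hs B hE j u hSt hS _
  obtain ⟨hdiff, -, -, hs, -⟩ := hE
  exact succCol_step hdiff (mul_nonneg hμ hs.le) hSt hS

/-- `succS_of_succColQ` — seam of the TiltedLandingLaw421 descent framework, part 08 (token-identical port of `Cruxes/TiltedLandingLaw421/Lines/law421birthS.lean`; no new mathematics). -/
theorem succS_of_succColQ {μ : ℝ} (hμ : 0 ≤ μ) {η : ℝ} {f : ℂ → ℂ} {x₀ s hmax R Hs : ℝ} {B : ℕ}
    (hE : EngineHyps5 2 η f x₀ s hmax R Hs B) {j : ℕ} {u : ℂ} (hSt : StCol η f x₀ s hmax R Hs B j u)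
    (hS : SuccColQ μ η f x₀ s hmax R Hs B j u) : SuccS μ η f x₀ s hmax R Hs B j u :=
  frozenStepSig_succColQ hμ (fun _ _ _ _ _ _ _ _ _ _ => False) η f x₀ s hmax R Hs B hE j u hSt hS (fun h => h)

/-- `surplusLiftSig_succS_of_succColQ` — seam of the TiltedLandingLaw421 descent framework, part 08 (token-identical port of `Cruxes/TiltedLandingLaw421/Lines/law421birthS.lean`; no new mathematics). -/
theorem surplusLiftSig_succS_of_succColQ {cE μ : ℝ} (hμ : 0 ≤ μ) {Λ : ℝ → ℝ → ℝ}
    (hS : SurplusLiftSig cE Λ StCol WindowReady (SuccColQ μ)) : SurplusLiftSig cE Λ StCol WindowReady (SuccS μ) :=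
  surplusLiftSig_succS_of_step hS (frozenStepSig_succColQ hμ WindowReady)

example (hS : SurplusLiftSig 0 (liftBudget (1 / 4) 0 1) StCol WindowReady (SuccColQ (1 / 4))) :
    SurplusLiftSig 0 (liftBudget (1 / 4) 0 1) StCol WindowReady (SuccS (1 / 4)) :=
  surplusLiftSig_succS_of_succColQ (by norm_num) hS

end RhIdea6.G19.W07C11.Seam
namespace RhIdea6.G19.W07C11.Seam
open RhIdea6.G17.W07C7 RhIdea6.G17.W07C7.Rev6 RhIdea6.G18.W07C8.Law421BirthS
/-- `SurplusLiftSigV'` — seam of the TiltedLandingLaw421 descent framework, part 08 (token-identical port of `Cruxes/TiltedLandingLaw421/Lines/law421birthS.lean`; no new mathematics). -/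
def SurplusLiftSigV' (μ cE : ℝ) (St Ready Frozen : StatePred) : Prop :=
  ∀ (η : ℝ) (f : ℂ → ℂ) (x₀ s hmax R Hs : ℝ) (B : ℕ), EngineHyps5 2 η f x₀ s hmax R Hs B →
    ∃ (E : Finset ℕ) (lam : ℕ → ℝ), (∀ j : ℕ, 0 ≤ lam j) ∧
      (E.card : ℝ) + (∑ e ∈ E, lam e) / (μ * s) ≤ (Hs / s) ^ 2 + B + cE ∧
      (∀ (j : ℕ) (u : ℂ), j ∉ E → St η f x₀ s hmax R Hs B j u →
        Ready η f x₀ s hmax R Hs B j u ∨ Frozen η f x₀ s hmax R Hs B j u) ∧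
      (∀ (j : ℕ) (u : ℂ), j ∈ E → St η f x₀ s hmax R Hs B j u → ¬ Ready η f x₀ s hmax R Hs B j u →
        ∃ u' : ℂ, St η f x₀ s hmax R Hs B (j + 1) u' ∧ |u'.im| ≤ |u.im| + lam j)

/-- `surplusLiftSigV'_of_V` — seam of the TiltedLandingLaw421 descent framework, part 08 (token-identical port of `Cruxes/TiltedLandingLaw421/Lines/law421birthS.lean`; no new mathematics). -/
theorem surplusLiftSigV'_of_V {μ cE : ℝ} (hcE : 0 ≤ cE) {St Ready Frozen : StatePred}
    (h : SurplusLiftSigV μ St Ready Frozen) : SurplusLiftSigV' μ cE St Ready Frozen := by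
  intro η f x₀ s hmax R Hs B hE
  obtain ⟨E, lam, hlam0, hsum, hoff, hon⟩ := h η f x₀ s hmax R Hs B hE
  exact ⟨E, lam, hlam0, by linarith, hoff, hon⟩

/-- `surplusLiftSigV'_of_fork_quarter` — seam of the TiltedLandingLaw421 descent framework, part 08 (token-identical port of `Cruxes/TiltedLandingLaw421/Lines/law421birthS.lean`; no new mathematics). -/
theorem surplusLiftSigV'_of_fork_quarter {cE c : ℝ} {St Ready Frozen : StatePred}
    (h : SurplusLiftSig cE (liftBudget (1 / 4) cE c) St Ready Frozen) : SurplusLiftSigV' (1 / 4) c St Ready Frozen := by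
  intro η f x₀ s hmax R Hs B hE
  have hE' := hE
  obtain ⟨-, -, -, hs, -⟩ := hE'
  obtain ⟨E, lam, hcard, hlam0, hsum, hoff, hon⟩ := h η f x₀ s hmax R Hs B hE
  refine ⟨E, lam, hlam0, ?_, hoff, hon⟩
  have hΛ : liftBudget (1 / 4) cE c s hmax = (c - cE) * (1 / 4 * s) := by simp only [liftBudget]; ring
  have hμs : 0 < 1 / 4 * s := by positivity
  have h1 : (∑ e ∈ E, lam e) / (1 / 4 * s) ≤ c - cE := by
    rw [div_le_iff₀ hμs]; rw [hΛ] at hsum; linarith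
  linarith

/-- `descentSigC_of_liftV'_pieces` — seam of the TiltedLandingLaw421 descent framework, part 08 (token-identical port of `Cruxes/TiltedLandingLaw421/Lines/law421birthS.lean`; no new mathematics). -/
theorem descentSigC_of_liftV'_pieces (μ cE c : ℝ) (hμ : 0 < μ) (hc : 0 ≤ c)
    (hbud : ∀ s hmax : ℝ, 0 < s → 2 * s ≤ hmax → hmax / (μ * s) + cE ≤ 4 * hmax / s + c)
    (St Ready Frozen : StatePred)
    (hI : Init0Sig St) (hSL : SurplusLiftSigV' μ cE St Ready Frozen) (hF : FrozenStepSig μ St Ready Frozen)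
    (hL : LandSig St Ready) : DescentSigC c := by
  intro η f x₀ s hmax R Hs B hE
  have hE' := hE
  obtain ⟨-, -, -, hs, hsh, -, -, -, -, -, -, -, -, -, -, -⟩ := hE'
  have hμs : 0 < μ * s := mul_pos hμ hs
  obtain ⟨E, lam, hlam0, hEsum, hEoff, hEon⟩ := hSL η f x₀ s hmax R Hs B hE
  obtain ⟨u₀, hSt0, hu₀⟩ := hI η f x₀ s hmax R Hs B hE

  let S : ℕ → Finset ℕ := fun j => E.filter (fun e => j ≤ e)
  let w : ℕ → ℝ := fun e => 1 + lam e / (μ * s)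
  let W : ℕ → ℝ := fun j => ∑ e ∈ S j, w e
  let Φ : ℕ → ℂ → ℝ := fun j u => |u.im| / (μ * s) + W j
  have hw0 : ∀ e, 0 ≤ w e := fun e => by
    have : 0 ≤ lam e / (μ * s) := div_nonneg (hlam0 e) hμs.le
    simp only [w]; linarith
  have hSins : ∀ j : ℕ, j ∈ E → S j = insert j (S (j + 1)) := by
    intro j hj
    ext e
    simp only [S, Finset.mem_filter, Finset.mem_insert]
    constructor
    · rintro ⟨he, hle⟩
      by_cases h : e = j
      · exact Or.inl h
      · exact Or.inr ⟨he, by omega⟩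
    · rintro (h | ⟨he, hle⟩)
      · subst h; exact ⟨hj, le_rfl⟩
      · exact ⟨he, by omega⟩
  have hSeq : ∀ j : ℕ, j ∉ E → S (j + 1) = S j := by
    intro j hj
    ext e
    simp only [S, Finset.mem_filter]
    constructor
    · rintro ⟨he, hle⟩; exact ⟨he, by omega⟩
    · rintro ⟨he, hle⟩
      have hne : j ≠ e := fun h => hj (h ▸ he)
      exact ⟨he, by omega⟩
  have hWon : ∀ j : ℕ, j ∈ E → W j = w j + W (j + 1) := by
    intro j hj
    have hnot : j ∉ S (j + 1) := by
      simp only [S, Finset.mem_filter, not_and, not_le]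
      intro _; omega
    simp only [W]
    rw [hSins j hj, Finset.sum_insert hnot]
  have hWoff : ∀ j : ℕ, j ∉ E → W (j + 1) = W j := by
    intro j hj
    simp only [W]
    rw [hSeq j hj]
  have hWnonneg : ∀ j, 0 ≤ W j := fun j => Finset.sum_nonneg (fun e _ => hw0 e)
  have hΦnonneg : ∀ (j : ℕ) (u : ℂ), 0 ≤ Φ j u := by
    intro j u
    have : 0 ≤ |u.im| / (μ * s) := div_nonneg (abs_nonneg _) hμs.le
    have := hWnonneg j
    simp only [Φ]
    linarith

  have hStep : ∀ (j : ℕ) (u : ℂ), St η f x₀ s hmax R Hs B j u → ¬ Ready η f x₀ s hmax R Hs B j u →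
      ∃ u' : ℂ, St η f x₀ s hmax R Hs B (j + 1) u' ∧ 0 ≤ Φ (j + 1) u' ∧ Φ (j + 1) u' + 1 ≤ Φ j u := by
    intro j u hSt hR
    by_cases hjE : j ∈ E
    ·
      obtain ⟨u', hSt', hle⟩ := hEon j u hjE hSt hR
      have hWj := hWon j hjE
      have hh : |u'.im| / (μ * s) ≤ |u.im| / (μ * s) + lam j / (μ * s) := by
        rw [← add_div]
        exact div_le_div_of_nonneg_right hle hμs.le
      refine ⟨u', hSt', hΦnonneg _ _, ?_⟩
      simp only [Φ]
      simp only [w] at hWj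
      linarith
    ·
      rcases hEoff j u hjE hSt with hRj | hFz
      · exact absurd hRj hR
      obtain ⟨u', hSt', hdrop⟩ := hF η f x₀ s hmax R Hs B hE j u hSt hFz hR
      have hh : |u'.im| / (μ * s) + 1 ≤ |u.im| / (μ * s) := by
        rw [← sub_nonneg]
        have hne : μ * s ≠ 0 := ne_of_gt hμs
        have : |u.im| / (μ * s) - (|u'.im| / (μ * s) + 1) = (|u.im| - |u'.im| - μ * s) / (μ * s) := by
          field_simp
          ring
        rw [this]
        exact div_nonneg (by linarith) hμs.le
      have hWj := hWoff j hjE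
      refine ⟨u', hSt', hΦnonneg _ _, ?_⟩
      simp only [Φ]
      linarith

  have hW0 : W 0 ≤ (Hs / s) ^ 2 + B + cE := by
    have hsub : S 0 ⊆ E := Finset.filter_subset _ _
    have h1 : W 0 ≤ ∑ e ∈ E, w e := Finset.sum_le_sum_of_subset_of_nonneg hsub (fun e _ _ => hw0 e)
    have h2 : ∑ e ∈ E, w e = (E.card : ℝ) + (∑ e ∈ E, lam e) / (μ * s) := by
      simp only [w, Finset.sum_add_distrib, Finset.sum_const, nsmul_eq_mul, mul_one, Finset.sum_div]
    linarith
  have hΦ0 : Φ 0 u₀ ≤ 4 * hmax / s + (Hs / s) ^ 2 + B + c := by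
    have h1 : |u₀.im| / (μ * s) ≤ hmax / (μ * s) := div_le_div_of_nonneg_right hu₀ hμs.le
    have h2 := hbud s hmax hs hsh
    simp only [Φ]
    linarith
  obtain ⟨j, u, hj, hSt, hR⟩ :=
    descent_core (St := St η f x₀ s hmax R Hs B) (Ready := Ready η f x₀ s hmax R Hs B) (Φ := Φ)
      hStep hSt0 hΦ0 (allowance_nonneg hs hsh hc)
  obtain ⟨hnz, α, β, H, hα, hβ, hW⟩ := hL η f x₀ s hmax R Hs B hE j u hSt hR
  exact ⟨j, α, β, H, hj, hα, hβ, hnz, hW⟩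

/-- `descentSigS'_of_liftV'_pieces` — seam of the TiltedLandingLaw421 descent framework, part 08 (token-identical port of `Cruxes/TiltedLandingLaw421/Lines/law421birthS.lean`; no new mathematics). -/
theorem descentSigS'_of_liftV'_pieces (μ : ℝ) (hμ : 1 / 4 ≤ μ) (St Ready Frozen : StatePred)
    (hI : Init0Sig St) (hSL : SurplusLiftSigV' μ 1 St Ready Frozen) (hF : FrozenStepSig μ St Ready Frozen)
    (hL : LandSig St Ready) : DescentSigS' :=
  descentSigS'_of_descentSigC
    (descentSigC_of_liftV'_pieces μ 1 1 (by linarith) zero_le_one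
      (fun s hmax hs hsh => by
        have h1 : hmax / (μ * s) ≤ hmax / (1 / 4 * s) :=
          div_le_div_of_nonneg_left (by linarith) (by positivity) (mul_le_mul_of_nonneg_right hμ hs.le)
        have h2 : hmax / (1 / 4 * s) = 4 * hmax / s := by
          rw [div_eq_div_iff (by positivity) (ne_of_gt hs)]; ring
        linarith)
      St Ready Frozen hI hSL hF hL)

example (St Ready Frozen : StatePred) (hI : Init0Sig St) (hS : SurplusLiftSig 0 (liftBudget (1 / 4) 0 1) St Ready Frozen)
    (hF : FrozenStepSig (1 / 4) St Ready Frozen) (hL : LandSig St Ready) : DescentSigS' :=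
  descentSigS'_of_liftV'_pieces (1 / 4) le_rfl St Ready Frozen hI (surplusLiftSigV'_of_fork_quarter hS) hF hL

/-- `TiltedLandingLaw421_of_piecesSV1` — seam of the TiltedLandingLaw421 descent framework, part 08 (token-identical port of `Cruxes/TiltedLandingLaw421/Lines/law421birthS.lean`; no new mathematics). -/
private theorem TiltedLandingLaw421_of_piecesSV1 :
    SurplusLiftSigV' (1 / 4) 1 StCol WindowReady (SuccS (1 / 4)) → AnalyticHereditySig →
      RhW07.Seam.Law421Statement :=
  fun hL hHer =>
    law421T_ofS' (descentSigS'_of_liftV'_pieces (1 / 4) le_rfl StCol WindowReady (SuccS (1 / 4)) init0Sig_stCol hL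
      (frozenStepSig_succS (1 / 4) WindowReady) landSig_stCol) hHer

/-- `descentSigS'_of_piecesSV1` — seam of the TiltedLandingLaw421 descent framework, part 08 (token-identical port of `Cruxes/TiltedLandingLaw421/Lines/law421birthS.lean`; no new mathematics). -/
theorem descentSigS'_of_piecesSV1 :
    SurplusLiftSigV' (1 / 4) 1 StCol WindowReady (SuccS (1 / 4)) → DescentSigS' :=
  fun hL => descentSigS'_of_liftV'_pieces (1 / 4) le_rfl StCol WindowReady (SuccS (1 / 4)) init0Sig_stCol hL
    (frozenStepSig_succS (1 / 4) WindowReady) landSig_stCol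

end RhIdea6.G19.W07C11.Seam
namespace RhIdea6.G20.W07C12.Frac
open Set Complex
open RhIdea6.G17.W07C7 RhIdea6.G17.W07C7.Rev6 RhIdea6.G18.W07C8.Law421BirthS RhIdea6.G19.W07C11.Seam
/-- `Purse` — seam of the TiltedLandingLaw421 descent framework, part 08 (token-identical port of `Cruxes/TiltedLandingLaw421/Lines/law421birthS.lean`; no new mathematics). -/
abbrev Purse : Type := ℝ → ℝ → ℝ → ℕ → ℝ

/-- `FracCensusSig` — seam of the TiltedLandingLaw421 descent framework, part 08 (token-identical port of `Cruxes/TiltedLandingLaw421/Lines/law421birthS.lean`; no new mathematics). -/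
def FracCensusSig (P : Purse) (V : Potential) (St Ready : StatePred) : Prop :=
  ∀ (η : ℝ) (f : ℂ → ℂ) (x₀ s hmax R Hs : ℝ) (B : ℕ), EngineHyps5 2 η f x₀ s hmax R Hs B →
    ∃ charge : ℕ → ℝ, (∀ j : ℕ, 0 ≤ charge j) ∧ (∀ N : ℕ, ∑ j ∈ Finset.range N, charge j ≤ P s hmax Hs B) ∧
      ∀ (j : ℕ) (u : ℂ), St η f x₀ s hmax R Hs B j u → ¬ Ready η f x₀ s hmax R Hs B j u →
        ∃ u' : ℂ, St η f x₀ s hmax R Hs B (j + 1) u' ∧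
          V η f x₀ s hmax R Hs B (j + 1) u' + 1 ≤ V η f x₀ s hmax R Hs B j u + charge j

/-- `InitVSig` — seam of the TiltedLandingLaw421 descent framework, part 08 (token-identical port of `Cruxes/TiltedLandingLaw421/Lines/law421birthS.lean`; no new mathematics). -/
def InitVSig (c : ℝ) (P : Purse) (V : Potential) (St : StatePred) : Prop :=
  ∀ (η : ℝ) (f : ℂ → ℂ) (x₀ s hmax R Hs : ℝ) (B : ℕ), EngineHyps5 2 η f x₀ s hmax R Hs B →
    ∃ u : ℂ, St η f x₀ s hmax R Hs B 0 u ∧ V η f x₀ s hmax R Hs B 0 u + P s hmax Hs B ≤ 4 * hmax / s + (Hs / s) ^ 2 + B + c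

/-- `VNonnegSig` — seam of the TiltedLandingLaw421 descent framework, part 08 (token-identical port of `Cruxes/TiltedLandingLaw421/Lines/law421birthS.lean`; no new mathematics). -/
def VNonnegSig (V : Potential) (St : StatePred) : Prop :=
  ∀ (η : ℝ) (f : ℂ → ℂ) (x₀ s hmax R Hs : ℝ) (B : ℕ), EngineHyps5 2 η f x₀ s hmax R Hs B →
    ∀ (j : ℕ) (u : ℂ), St η f x₀ s hmax R Hs B j u → 0 ≤ V η f x₀ s hmax R Hs B j u

/-- `LandLeSig` — seam of the TiltedLandingLaw421 descent framework, part 08 (token-identical port of `Cruxes/TiltedLandingLaw421/Lines/law421birthS.lean`; no new mathematics). -/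
def LandLeSig (St Ready : StatePred) : Prop :=
  ∀ (η : ℝ) (f : ℂ → ℂ) (x₀ s hmax R Hs : ℝ) (B : ℕ), EngineHyps5 2 η f x₀ s hmax R Hs B →
    ∀ (j : ℕ) (u : ℂ), St η f x₀ s hmax R Hs B j u → Ready η f x₀ s hmax R Hs B j u →
      ∃ j' : ℕ, j' ≤ j ∧ iteratedDeriv j' f ≠ 0 ∧ ∃ (α β H : ℝ), x₀ - (j' + 3) * R / 2 ≤ α ∧ β ≤ x₀ + (j' + 3) * R / 2 ∧
        SignWindow (iteratedDeriv j' f) α β H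

/-- `landLeSig_of_landSig` — seam of the TiltedLandingLaw421 descent framework, part 08 (token-identical port of `Cruxes/TiltedLandingLaw421/Lines/law421birthS.lean`; no new mathematics). -/
theorem landLeSig_of_landSig {St Ready : StatePred} (h : LandSig St Ready) : LandLeSig St Ready := by
  intro η f x₀ s hmax R Hs B hE j u hSt hR
  obtain ⟨hnz, α, β, H, hα, hβ, hW⟩ := h η f x₀ s hmax R Hs B hE j u hSt hR
  exact ⟨j, le_rfl, hnz, α, β, H, hα, hβ, hW⟩

/-- `descentSigC_of_fracCensus` — seam of the TiltedLandingLaw421 descent framework, part 08 (token-identical port of `Cruxes/TiltedLandingLaw421/Lines/law421birthS.lean`; no new mathematics). -/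
theorem descentSigC_of_fracCensus (c : ℝ) (hc : 0 ≤ c) (P : Purse) (V : Potential) (St Ready : StatePred)
    (hV : VNonnegSig V St) (hI : InitVSig c P V St) (hC : FracCensusSig P V St Ready) (hL : LandLeSig St Ready) :
    DescentSigC c := by
  intro η f x₀ s hmax R Hs B hE
  have hE' := hE
  obtain ⟨-, -, -, hs, hsh, -⟩ := hE'
  obtain ⟨charge, hch0, hchP, hstep⟩ := hC η f x₀ s hmax R Hs B hE
  obtain ⟨u₀, hSt0, hV0⟩ := hI η f x₀ s hmax R Hs B hE

  let Φ : ℕ → ℂ → ℝ := fun j u => V η f x₀ s hmax R Hs B j u + (P s hmax Hs B - ∑ i ∈ Finset.range j, charge i)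
  have hStep : ∀ (j : ℕ) (u : ℂ), St η f x₀ s hmax R Hs B j u → ¬ Ready η f x₀ s hmax R Hs B j u →
      ∃ u' : ℂ, St η f x₀ s hmax R Hs B (j + 1) u' ∧ 0 ≤ Φ (j + 1) u' ∧ Φ (j + 1) u' + 1 ≤ Φ j u := by
    intro j u hSt hR
    obtain ⟨u', hSt', hle⟩ := hstep j u hSt hR
    have hsum : ∑ i ∈ Finset.range (j + 1), charge i = ∑ i ∈ Finset.range j, charge i + charge j :=
      Finset.sum_range_succ _ _
    have hV' : 0 ≤ V η f x₀ s hmax R Hs B (j + 1) u' := hV η f x₀ s hmax R Hs B hE (j + 1) u' hSt'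
    have hP' : ∑ i ∈ Finset.range (j + 1), charge i ≤ P s hmax Hs B := hchP (j + 1)
    refine ⟨u', hSt', ?_, ?_⟩
    · simp only [Φ]
      linarith
    · simp only [Φ]
      rw [hsum]
      linarith
  have hΦ0 : Φ 0 u₀ ≤ 4 * hmax / s + (Hs / s) ^ 2 + B + c := by
    simp only [Φ, Finset.range_zero, Finset.sum_empty, sub_zero]
    linarith
  obtain ⟨j, u, hj, hSt, hR⟩ :=
    descent_core (St := St η f x₀ s hmax R Hs B) (Ready := Ready η f x₀ s hmax R Hs B) (Φ := Φ)
      hStep hSt0 hΦ0 (allowance_nonneg hs hsh hc)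
  obtain ⟨j', hj', hnz, α, β, H, hα, hβ, hW⟩ := hL η f x₀ s hmax R Hs B hE j u hSt hR
  have hjj : (j' : ℝ) ≤ j := by exact_mod_cast hj'
  exact ⟨j', α, β, H, by linarith, hα, hβ, hnz, hW⟩

/-- `fracCensus_mono_purse` — seam of the TiltedLandingLaw421 descent framework, part 08 (token-identical port of `Cruxes/TiltedLandingLaw421/Lines/law421birthS.lean`; no new mathematics). -/
theorem fracCensus_mono_purse {P P' : Purse} (hP : ∀ s hmax Hs B, P s hmax Hs B ≤ P' s hmax Hs B) {V : Potential} {St Ready : StatePred}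
    (h : FracCensusSig P V St Ready) : FracCensusSig P' V St Ready := by
  intro η f x₀ s hmax R Hs B hE
  obtain ⟨charge, hch0, hchP, hstep⟩ := h η f x₀ s hmax R Hs B hE
  exact ⟨charge, hch0, fun N => (hchP N).trans (hP s hmax Hs B), hstep⟩

/-- `fracCensus_mono_ready` — seam of the TiltedLandingLaw421 descent framework, part 08 (token-identical port of `Cruxes/TiltedLandingLaw421/Lines/law421birthS.lean`; no new mathematics). -/
theorem fracCensus_mono_ready {Ready Ready' : StatePred}
    (hR : ∀ η f x₀ s hmax R Hs B j u, Ready η f x₀ s hmax R Hs B j u → Ready' η f x₀ s hmax R Hs B j u)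
    {P : Purse} {V : Potential} {St : StatePred} (h : FracCensusSig P V St Ready) : FracCensusSig P V St Ready' := by
  intro η f x₀ s hmax R Hs B hE
  obtain ⟨charge, hch0, hchP, hstep⟩ := h η f x₀ s hmax R Hs B hE
  exact ⟨charge, hch0, hchP, fun j u hSt hR' => hstep j u hSt (fun hRj => hR' (hR _ _ _ _ _ _ _ _ _ _ hRj))⟩

/-- `CumReady` — seam of the TiltedLandingLaw421 descent framework, part 08 (token-identical port of `Cruxes/TiltedLandingLaw421/Lines/law421birthS.lean`; no new mathematics). -/
def CumReady (Ready : StatePred) : StatePred := fun η f x₀ s hmax R Hs B j u =>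
  ∃ j' : ℕ, j' ≤ j ∧ Ready η f x₀ s hmax R Hs B j' u

/-- `cumReady_of_ready` — seam of the TiltedLandingLaw421 descent framework, part 08 (token-identical port of `Cruxes/TiltedLandingLaw421/Lines/law421birthS.lean`; no new mathematics). -/
theorem cumReady_of_ready {Ready : StatePred} {η : ℝ} {f : ℂ → ℂ} {x₀ s hmax R Hs : ℝ} {B j : ℕ} {u : ℂ}
    (h : Ready η f x₀ s hmax R Hs B j u) : CumReady Ready η f x₀ s hmax R Hs B j u :=
  ⟨j, le_rfl, h⟩

/-- `ne_zero_of_signWindow` — seam of the TiltedLandingLaw421 descent framework, part 08 (token-identical port of `Cruxes/TiltedLandingLaw421/Lines/law421birthS.lean`; no new mathematics). -/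
theorem ne_zero_of_signWindow {g : ℂ → ℂ} {α β H : ℝ} (h : SignWindow g α β H) : g ≠ 0 := by
  intro hg
  apply h.2.2.1
  rw [hg]
  rfl

/-- `landLeSig_cumReady` — seam of the TiltedLandingLaw421 descent framework, part 08 (token-identical port of `Cruxes/TiltedLandingLaw421/Lines/law421birthS.lean`; no new mathematics). -/
theorem landLeSig_cumReady (St : StatePred) : LandLeSig St (CumReady WindowReady) := by
  intro η f x₀ s hmax R Hs B _ j u _ hR
  obtain ⟨j', hj', α, β, H, hα, hβ, hW⟩ := hR
  exact ⟨j', hj', ne_zero_of_signWindow hW, α, β, H, hα, hβ, hW⟩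

/-- `fracCensus_cumReady_of` — seam of the TiltedLandingLaw421 descent framework, part 08 (token-identical port of `Cruxes/TiltedLandingLaw421/Lines/law421birthS.lean`; no new mathematics). -/
theorem fracCensus_cumReady_of {P : Purse} {V : Potential} {St Ready : StatePred} (h : FracCensusSig P V St Ready) :
    FracCensusSig P V St (CumReady Ready) :=
  fracCensus_mono_ready (fun _ _ _ _ _ _ _ _ _ _ hRj => cumReady_of_ready hRj) h

/-- `VLin` — seam of the TiltedLandingLaw421 descent framework, part 08 (token-identical port of `Cruxes/TiltedLandingLaw421/Lines/law421birthS.lean`; no new mathematics). -/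
noncomputable def VLin (μ : ℝ) : Potential := fun _η _f _x₀ s _hmax _R _Hs _B _j u => |u.im| / (μ * s)

/-- `PLin` — seam of the TiltedLandingLaw421 descent framework, part 08 (token-identical port of `Cruxes/TiltedLandingLaw421/Lines/law421birthS.lean`; no new mathematics). -/
noncomputable def PLin (cE : ℝ) : Purse := fun s _hmax Hs B => (Hs / s) ^ 2 + B + cE

/-- `VLQ` — seam of the TiltedLandingLaw421 descent framework, part 08 (token-identical port of `Cruxes/TiltedLandingLaw421/Lines/law421birthS.lean`; no new mathematics). -/
noncomputable def VLQ : Potential := fun _η _f _x₀ s _hmax _R _Hs _B _j u => 4 * |u.im| / s + (|u.im| / s) ^ 2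

/-- `PB` — seam of the TiltedLandingLaw421 descent framework, part 08 (token-identical port of `Cruxes/TiltedLandingLaw421/Lines/law421birthS.lean`; no new mathematics). -/
noncomputable def PB (cB : ℝ) : Purse := fun _s _hmax _Hs B => (B : ℝ) + cB

/-- `vNonneg_lin` — seam of the TiltedLandingLaw421 descent framework, part 08 (token-identical port of `Cruxes/TiltedLandingLaw421/Lines/law421birthS.lean`; no new mathematics). -/
theorem vNonneg_lin {μ : ℝ} (hμ : 0 < μ) (St : StatePred) : VNonnegSig (VLin μ) St := by
  intro η f x₀ s hmax R Hs B hE j u _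
  obtain ⟨-, -, -, hs, -⟩ := hE
  simp only [VLin]
  exact div_nonneg (abs_nonneg _) (mul_pos hμ hs).le


end RhIdea6.G20.W07C12.Frac
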